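import Literature.Computability.Cryptography.WordRAMToTM2XRegs
import Literature.Computability.Complexity.StackUnaryBits
import HarnessLib

/-!
# Word-RAM oracle programs on multi-stack machines, II: rebuilding the memory log as a table

Family `fine-grained`, continuing `WordRAMToTM2XRegs.lean`. The interpreter of
`WordRAMToTM2Interp.lean` keeps the memory of the word RAM as an append-only log of (address,
value) entries, one entry per write, so that a lookup costs time proportional to the number of
steps simulated so far and a run of `T` steps costs `Θ(T²)`; this serves ETH-type statements but
not SETH-type ones. When every address ever written is at most `A` (the situation of an oracle
program run at word size `O(log n)` with short oracle answers: values, addresses and query lengths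
are bounded by the value bound `V`, `WordRAM.run_memLE_of_queries`), the log can be replaced after
every step by the **table** of the cells `0, …, A` (`tableLog mem (A + 1)`: one entry per address,
so `A + 1` entries whatever the history), which is what this file provides:

* `tableLog mem n` — the entries `(encodeNat a, encodeNat (mem a))` for `a < n`, newest `= n - 1`
  first; `represents_tableLog` (it represents `mem` as soon as `mem` vanishes from `n` on),
  `boundedLog_tableLog`, `length_tableLog`;
* `rbIter` / `runs_rbIter` — one address: copy the address numeral to `key`, `memRead`, push the
  entry (key, value) onto the new log `nl`, increment the address (`Com.incr`);
* `rebuild` / `runs_rebuild` — copy the master counter `un = 1^{n}` to `cnt`, iterate `rbIter` under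
  it from address `0`, clear the address, replace the log `mem` by the new log; from a clean
  interpreter file whose log `E` represents `mem` it leads to the same file with the log
  `tableLog mem n`, within `rebuildCost |encLog E| β n` (`β` a bound on all numerals involved).

## References

* S. A. Cook, R. A. Reckhow, *Time bounded random access machines*, JCSS 7 (1973) 354–375, §2
  (a RAM memory held as a table on a tape).
* D. E. Knuth, *The Art of Computer Programming*, vol. 2, 3rd ed., 1997, §4.3.1 (increment).
-/

namespace Literature.Computability.Cryptography.WordRAM.ToTM2

open _root_.Computability Complexity Complexity.Com

/-! ### The table log -/

/-- The table of the cells `0, …, n - 1` as a log: entries `(encodeNat a, encodeNat (mem a))`,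
address `n - 1` first. [folklore] -/
def tableLog (mem : ℕ → ℕ) : ℕ → List (List Bool × List Bool)
  | 0 => []
  | n + 1 => (encodeNat n, encodeNat (mem n)) :: tableLog mem n

/-- The table of `n` cells has `n` entries. [folklore] -/
@[simp] theorem length_tableLog (mem : ℕ → ℕ) : ∀ n, (tableLog mem n).length = n
  | 0 => rfl
  | n + 1 => by simp [tableLog, length_tableLog mem n]

/-- Lookup in the table: the numeral of `mem a` for `a < n`, nothing beyond. [folklore] -/
theorem logLookup_tableLog (mem : ℕ → ℕ) (a : ℕ) : ∀ n,
    logLookup (tableLog mem n) (encodeNat a) = if a < n then encodeNat (mem a) else []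
  | 0 => by simp [tableLog, logLookup]
  | n + 1 => by
    simp only [tableLog, logLookup, encodeNat_eq_encodeNat_iff]
    by_cases h : n = a
    · subst h; simp
    · rw [if_neg h, logLookup_tableLog mem a n]
      by_cases h' : a < n
      · simp [h', Nat.lt_succ_of_lt h']
      · have : ¬ a < n + 1 := by omega
        simp [h', this]

/-- **The table represents the memory** as soon as the memory vanishes from `n` on. [folklore] -/
theorem represents_tableLog {mem : ℕ → ℕ} {n : ℕ} (h : ∀ a, n ≤ a → mem a = 0) :
    Represents (tableLog mem n) mem := by
  intro a
  rw [logLookup_tableLog]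
  split_ifs with ha
  · rfl
  · rw [h a (not_lt.1 ha)]; decide

/-- The table is a bounded log when addresses `< n` and all values have numerals of at most `β`
bits. [folklore] -/
theorem boundedLog_tableLog {mem : ℕ → ℕ} {β : ℕ} (hv : ∀ a, (encodeNat (mem a)).length ≤ β) :
    ∀ {n}, (∀ a, a < n → (encodeNat a).length ≤ β) → BoundedLog β (tableLog mem n)
  | 0, _ => fun e he => by simp [tableLog] at he
  | n + 1, hn => by
    intro e he
    simp only [tableLog, List.mem_cons] at he
    rcases he with rfl | he
    · exact ⟨hn n (Nat.lt_succ_self n), hv n⟩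
    · exact boundedLog_tableLog hv (fun a ha => hn a (Nat.lt_succ_of_lt ha)) e he

/-! ### One address -/

/-- `rbIter`: one iteration of the rebuild at the address held (as a numeral) in `ad`: copy it to
`key`, read the memory, push the entry (key, value) onto the new log `nl` (value item, then key
item, as `memWrite` does on the log), increment the address. [folklore] -/
def rbIter : Com RQ :=
  ((((copy (rX .ad) (rK .key) (rX .s1) (rX .s2) ;; memRead.map Sum.inl) ;;
      pushItemG (rK .val) (rX .nl) true) ;; pour (rK .key) (rK .key2)) ;;
      pushItemG (rK .key2) (rX .nl) false) ;; incr (rX .ad) (rX .s1) (rX .s2) (rX .s3)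

/-- The cost of one iteration on a log of code length `L` with numerals of at most `β` bits.
[folklore] -/
def rbIterCost (L β : ℕ) : ℕ := L * (3 * β + 17) + 30 * β + 33

/-- `rbIterCost` is monotone in the log length. [folklore] -/
theorem rbIterCost_mono {L L' : ℕ} (h : L ≤ L') (β : ℕ) : rbIterCost L β ≤ rbIterCost L' β := by
  unfold rbIterCost; have := Nat.mul_le_mul_right (3 * β + 17) h; omega

/-- The interpreter-side registers used by the rebuild are clean: the log is `encLog E` and the
scan/key/value registers are empty (the program counter, ruler, run flag and all other registers
are arbitrary). [folklore] -/
structure RbClean (ρ : St) (E : List (List Bool × List Bool)) : Prop where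
  mem : ρ.mem = encLog E
  mem2 : ρ.mem2 = []
  key : ρ.key = []
  key2 : ρ.key2 = []
  val : ρ.val = []
  st1 : ρ.st1 = []
  st2 : ρ.st2 = []
  ph : ρ.ph = []
  eqf : ρ.eqf = []
  found : ρ.found = []
  tmp : ρ.tmp = []

/-- A configuration file of the interpreter is clean for the rebuild. [folklore] -/
theorem rbClean_cfgSt (W : ℕ) (E : List (List Bool × List Bool)) (pc : Option ℕ) (run : List Bool) :
    RbClean (cfgSt W E pc run) E :=
  ⟨rfl, rfl, rfl, rfl, rfl, rfl, rfl, rfl, rfl, rfl, rfl⟩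

/-- **One iteration.** At address `a` (numeral on `ad`), with the partial new log `N` on `nl`,
empty scratch `s1 s2 s3`, and a clean interpreter file whose log `E` represents `mem`: afterwards
`ad` holds the numeral of `a + 1` and `nl` the log `(encodeNat a, encodeNat (mem a)) :: N`,
everything else unchanged, within `rbIterCost |encLog E| β` provided the numerals of `a` and of
`mem a` have at most `β` bits. [folklore] -/
theorem runs_rbIter {ρ : St} {E : List (List Bool × List Bool)} (hc : RbClean ρ E) {mem : ℕ → ℕ}
    (hrep : Represents E mem) (F : Regs AReg) (T : XS) (hs1 : T.s1 = []) (hs2 : T.s2 = [])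
    (hs3 : T.s3 = []) {a : ℕ} (had : T.ad = encodeNat a) {N : List (List Bool × List Bool)}
    (hnl : T.nl = encLog N) {β : ℕ} (ha : (encodeNat a).length ≤ β) (hv : (encodeNat (mem a)).length ≤ β) :
    Runs rbIter (stateQ ρ F T)
      (stateQ ρ F { T with ad := encodeNat (a + 1), nl := encLog ((encodeNat a, encodeNat (mem a)) :: N) })
      (rbIterCost (encLog E).length β) := by
  unfold rbIter rbIterCost
  -- copy the address to `key`
  have h1 := runs_copy (a := rX .ad) (b := rK .key) (t := rX .s1) (u := rX .s2) (by simp) (by simp) (by simp)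
    (by simp) (by simp) (by simp) (stateQ ρ F T) (by simp [hs1]) (by simp [hs2])
  simp only [stateQ_rX, XS.regs_ad, had, stateQ_rK, St.regs_key, hc.key, List.append_nil,
    update_stateQ_rK, update_state_inl, St.update_regs_key] at h1
  -- read the memory
  have h2 := h1.seq (runs_inl_stateQ (runs_memRead { ρ with key := encodeNat a } F E (encodeNat a)
    (by simp [hc.mem]) rfl (by simp [hc.mem2]) (by simp [hc.key2]) (by simp [hc.val]) (by simp [hc.st1])
    (by simp [hc.st2]) (by simp [hc.ph]) (by simp [hc.eqf]) (by simp [hc.found])) T)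
  rw [hrep.lookup a] at h2
  -- push the value item
  have h3 := h2.seq (runs_pushItemG (src := rK .val) (dst := rX .nl) (by simp) true _)
  simp only [stateQ_rK, St.regs_val, stateQ_rX, XS.regs_nl, hnl, update_stateQ_rK, update_state_inl,
    St.update_regs_val, update_stateQ_rX, XS.update_regs_nl] at h3
  -- pour the key onto `key2`
  have h4 := h3.seq (runs_pour (a := rK .key) (b := rK .key2) (by simp) _)
  simp only [stateQ_rK, St.regs_key, St.regs_key2, hc.key2, List.append_nil, update_stateQ_rK,
    update_state_inl, St.update_regs_key, St.update_regs_key2] at h4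
  -- push the key item
  have h5 := h4.seq (runs_pushItemG (src := rK .key2) (dst := rX .nl) (by simp) false _)
  simp only [stateQ_rK, St.regs_key2, stateQ_rX, XS.regs_nl, update_stateQ_rK, update_state_inl,
    St.update_regs_key2, update_stateQ_rX, XS.update_regs_nl] at h5
  -- increment the address
  have h6 := h5.seq (runs_incr (B := rX .ad) (t := rX .s1) (t2 := rX .s2) (fl := rX .s3) (by simp) (by simp)
    (by simp) (by simp) (by simp) (by simp) _ (by simp [hs1]) (by simp [hs2]) (by simp [hs3]))
  simp only [stateQ_rX, XS.regs_ad, had, update_stateQ_rX, XS.update_regs_ad] at h6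
  rw [← TokConv.encodeNat_succ_eq_incRes] at h6
  refine h6.of_eq ?_ ?_
  · -- the final state
    have e : ({ ρ with key := [], val := [], key2 := [] } : St) = ρ := by
      have h1 := hc.key; have h2 := hc.val; have h3 := hc.key2
      cases ρ; simp only at h1 h2 h3; simp [h1, h2, h3]
    simp only [encLog_cons, List.append_assoc, e]
  · simp only [List.length_reverse]
    have l1 := ha; have l2 := hv
    nlinarith [l1, l2]

/-! ### The rebuild loop -/

/-- `rebuild`: copy the master counter `un` to `cnt`; iterate `rbIter` under `cnt` from the current
address (`0` when the address register is empty); clear the address; replace the log by the new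
log. [folklore] -/
def rebuild : Com RQ :=
  (((copy (rX .un) (rX .cnt) (rX .s1) (rX .s2) ;; loop (rX .cnt) rbIter rbIter) ;; clear (rX .ad)) ;;
    clear (rK .mem)) ;; move (rX .nl) (rK .mem) (rX .s1)

/-- **The loop.** Under the counter `cnt = 1^m`, from address `a` with the partial table
`tableLog mem a` on `nl`, the loop ends at address `a + m` with `tableLog mem (a + m)` on `nl`,
within `m · (rbIterCost |encLog E| β + 2) + 1`, provided all addresses `< a + m` and all values
have numerals of at most `β` bits. [folklore] -/
theorem runs_rbLoop {ρ : St} {E : List (List Bool × List Bool)} (hc : RbClean ρ E) {mem : ℕ → ℕ}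
    (hrep : Represents E mem) (F : Regs AReg) {β : ℕ} (hv : ∀ a, (encodeNat (mem a)).length ≤ β) :
    ∀ (m a : ℕ) (T : XS), T.s1 = [] → T.s2 = [] → T.s3 = [] → T.cnt = ones m → T.ad = encodeNat a →
      T.nl = encLog (tableLog mem a) → (∀ b, b < a + m → (encodeNat b).length ≤ β) →
      Runs (loop (rX .cnt) rbIter rbIter) (stateQ ρ F T)
        (stateQ ρ F { T with cnt := [], ad := encodeNat (a + m), nl := encLog (tableLog mem (a + m)) })
        (m * (rbIterCost (encLog E).length β + 2) + 1)
  | 0, a, T, _, _, _, hcnt, had, hnl, _ => by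
    refine (Runs.loop_nil _ _ (R := stateQ ρ F T) (by simp [hcnt])).of_eq ?_ (by simp)
    cases T; simp only at hcnt had hnl; simp [hcnt, had, hnl]
  | m + 1, a, T, hs1, hs2, hs3, hcnt, had, hnl, hb => by
    have hk : stateQ ρ F T (rX .cnt) = true :: ones m := by simp [hcnt, ones_succ]
    have hbody := runs_rbIter hc hrep F { T with cnt := ones m } hs1 hs2 hs3 had hnl
      (hb a (by omega)) (hv a)
    have ih := runs_rbLoop hc hrep F hv m (a + 1)
      { T with cnt := ones m, ad := encodeNat (a + 1), nl := encLog ((encodeNat a, encodeNat (mem a)) :: tableLog mem a) }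
      hs1 hs2 hs3 rfl rfl rfl (fun b hb' => hb b (by omega))
    refine (Runs.loop_true' hk (by simp) hbody ih).of_eq ?_ ?_
    · simp only [show a + 1 + m = a + (m + 1) by omega]
    · ring_nf; omega

/-- The cost of the rebuild on a log of code length `L`, numerals of `≤ β` bits, table size `n`.
[folklore] -/
def rebuildCost (L β n : ℕ) : ℕ :=
  10 * n + 3 + (n * (rbIterCost L β + 2) + 1) + (2 * β + 1) + (2 * L + 1) + (6 * ((4 * β + 4) * n) + 2)

/-- `rebuildCost` is monotone in the log length. [folklore] -/
theorem rebuildCost_mono {L L' : ℕ} (h : L ≤ L') (β n : ℕ) : rebuildCost L β n ≤ rebuildCost L' β n := by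
  unfold rebuildCost
  have := Nat.mul_le_mul_left n (Nat.add_le_add_right (rbIterCost_mono h β) 2)
  omega

/-- **The rebuild.** From a clean interpreter file whose log `E` represents `mem`, with the master
counter `un = 1^n`, empty `cnt ad nl s1 s2 s3`, where `mem` vanishes from `n` on and all addresses
`≤ n` and values have numerals of at most `β` bits: the rebuild replaces the log by the table
`tableLog mem n` and restores everything else, within `rebuildCost |encLog E| β n`. [folklore] -/
theorem runs_rebuild {ρ : St} {E : List (List Bool × List Bool)} (hc : RbClean ρ E) {mem : ℕ → ℕ}
    (hrep : Represents E mem) (F : Regs AReg) {β n : ℕ} (hv : ∀ a, (encodeNat (mem a)).length ≤ β)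
    (hn : ∀ b, b ≤ n → (encodeNat b).length ≤ β) (T : XS) (hs1 : T.s1 = []) (hs2 : T.s2 = [])
    (hs3 : T.s3 = []) (hun : T.un = ones n) (hcnt : T.cnt = []) (had : T.ad = []) (hnl : T.nl = []) :
    Runs rebuild (stateQ ρ F T) (stateQ { ρ with mem := encLog (tableLog mem n) } F T)
      (rebuildCost (encLog E).length β n) := by
  unfold rebuild rebuildCost
  -- copy the counter
  have h1 := runs_copy (a := rX .un) (b := rX .cnt) (t := rX .s1) (u := rX .s2) (by simp) (by simp) (by simp)
    (by simp) (by simp) (by simp) (stateQ ρ F T) (by simp [hs1]) (by simp [hs2])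
  simp only [stateQ_rX, XS.regs_un, XS.regs_cnt, hcnt, List.append_nil, update_stateQ_rX,
    XS.update_regs_cnt] at h1
  -- the loop
  have h2 := h1.seq (runs_rbLoop hc hrep F hv n 0 { T with cnt := T.un } hs1 hs2 hs3 hun
    (by rw [show ({ T with cnt := T.un } : XS).ad = T.ad from rfl, had]; decide)
    (by rw [show ({ T with cnt := T.un } : XS).nl = T.nl from rfl, hnl]; rfl) (fun b hb => hn b (by omega)))
  simp only [Nat.zero_add] at h2
  -- clear the address
  have h3 := h2.seq (runs_clear (rX .ad) _)
  simp only [stateQ_rX, XS.regs_ad, update_stateQ_rX, XS.update_regs_ad] at h3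
  -- clear the old log
  have h4 := h3.seq (runs_clear (rK .mem) _)
  simp only [stateQ_rK, St.regs_mem, hc.mem, update_stateQ_rK, update_state_inl, St.update_regs_mem] at h4
  -- move the new log into place
  have h5 := h4.seq (runs_move (a := rX .nl) (b := rK .mem) (t := rX .s1) (by simp) (by simp) (by simp) _
    (by simp [hs1]))
  simp only [stateQ_rX, XS.regs_nl, stateQ_rK, St.regs_mem, List.append_nil, update_stateQ_rX,
    XS.update_regs_nl, update_stateQ_rK, update_state_inl, St.update_regs_mem] at h5
  refine h5.of_eq ?_ ?_
  · -- the final state: `T` restored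
    congr 1
    cases T; simp only at hcnt had hnl; simp [hcnt, had, hnl]
  · have hL : (encLog (tableLog mem n)).length ≤ (4 * β + 4) * n := by
      have := length_encLog_le (boundedLog_tableLog hv (n := n) (fun a ha => hn a ha.le))
      rwa [length_tableLog] at this
    have hN : (encodeNat n).length ≤ β := hn n le_rfl
    have hU : T.un.length = n := by rw [hun]; simp [ones]
    rw [hU]
    have := Nat.mul_le_mul_left 6 hL
    omega

end Literature.Computability.Cryptography.WordRAM.ToTM2
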